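import Summits.QuantumFields.YangMills.Theorems.BalabanUVNodesN15KingModelFullPropagatorL2LocalRate

/-!
# BalabanUVNodes ∕ N15 — THE KING-MODEL RUNG, CURVED EDITION (PART Π-b): THE η-RATE OF THE LOCALISED `L²` GRADIENT ENTRY `h∇Gλ` OF [B9]'s (3.46) AT
# `U ≡ 1`, UNIFORM IN THE SCALE SHIFT `n` — `‖h·(N′∇′_μA₀′⁻¹(λ∘π) − (N∇_μA₀⁻¹λ)∘π)‖_{ℓ²(η′)} ≤ C·|h|_∞·(L^{−γ∕2})^K·e^{−δ|b−b′|}·‖λ‖_{ℓ²(η)}`, `0 ≤ γ < 1`,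
# for King's full `A = 0` propagator, UNIFORMLY in `K`, `n`, the volume and the mass
# (Track A, DAG node N15 = NE2; FAN-OUT v1.1 §N15 s3 «KING-MODEL RUNG … + the one-line statement of what the curved case adds»)

HONEST FRAMING.  Count-neutral operator bookkeeping (cell `pub-ymgap`, seat `pub-ymgap-dag-n15-e` g10; `--supports stmt-QuantumFields-20544 --as helper` = K3⁷
`SpineGivenEndpointR13SepCoPH`, WORDS-143).  TEMPLATE LITERATURE, `A = 0`: C. King's scalar U(1)-Higgs MODEL on finite tori ([King1986] (2.13)–(2.17) p. 653,
Prop. 3.8 (3.71) p. 664, Prop. 3.9 (3.73) p. 665), NOT Bałaban's covariant objects.  The gradient twin of part Π (`fullPropOp_l2_local_rate`): the pair operator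
`λ ↦ N′∇′_μA₀′⁻¹(λ∘π) − (N∇_μA₀⁻¹λ)∘π` is a kernel operator on the η′-lattice applied to `λ∘π` with kernel `N′^{−(d+1)}[N′δ′_μG′(x′, y′) − Nδ_μG(πx′, πy′)]`
(part S-f's RATE PROFILE with decay, level weight `Λ = (L^{d+1}∕L²)·L = L^d`); part Π's row-sum lemma at the paired ratio `t = L^{γ∕2−1} < 1` and unpaired
ratio `L⁻¹ ≤ θ`, part Ξ-a's Schur step, and the ℓ²-isometry of King's pairing give the operator rate `C·θ^K`, uniform in `n`.  An NE2-TYPE statement for the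
(3.46) layer, decided in the MODEL at `U ≡ 1`; NOT Bałaban's `G(U)`; NE2⁺ is NOT PRINTED and not proved; NOT a node discharge; nothing continuum ∕ ℝ⁴ ∕ OS ∕
mass-gap ∕ Clay.  0 `sorry`, 0 `def`, standard axioms.
* ★★ **`fullPropDOp_l2_local_rate`**.
WHAT THE CURVED CASE ADDS (one line): the same rate for `G′(U)`'s (3.46) gradient entry over `Reg335` — NOT printed ([B9] prints η-uniformity).
HONEST SCOPE.  (i) `A = 0`, periodic b.c., odd `L ≥ 3`, cubes `2L^e`, `K, n ≥ 1`, `0 < m² ≤ m₀²`; (ii) King's spelling; weighted `ℓ²` sums; forward η-differences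
(`N′δ′` on the fine run, `Nδ` on the coarse run at the coarse point `πx′`); King's pairing; (iii) single-block cut-off ∕ source; (iv) `0 ≤ γ < 1`; (v) not
Bałaban's `G(U)`; not a discharge.
Locators: [Balaban1985BackgroundPropagators] Thm 3.1 (3.46) p. 398; [King1986] (2.13)–(2.17) p. 653, Prop. 3.8 (3.71) p. 664, Prop. 3.9 (3.73) p. 665.
-/

noncomputable section

namespace Summit.QuantumFields.YangMills.BalabanUVNodes.N15KingModelRung.Curved

open Real Finset Matrix
open Literature.MathematicalPhysics.QuantumFieldTheory.Balaban1983to89.B5Prop11Plancherel (Tor fine unitVec)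
open Literature.MathematicalPhysics.QuantumFieldTheory.King1986 (aK aK_pos)
open Literature.MathematicalPhysics.QuantumFieldTheory.King1986.Torus (fineOp constrainedProp blockOf tdistT tdistT_nonneg tdistT_symm
  tdistT_self)

variable {d : ℕ} (L : ℕ) [NeZero L]

set_option maxHeartbeats 400000 in
/-- ★★ **THE η-RATE OF THE LOCALISED `L²` ENTRY `h∇Gλ` — AN NE2-TYPE STATEMENT FOR THE (3.46) LAYER, UNIFORM IN `n`.**  For odd `L ≥ 3`, `a > 0`, `m₀² ≥ 0`
and `0 ≤ γ < 1` there are `C, δ > 0` such that for EVERY `K ≥ 1`, `n ≥ 1` (`N = L^K`, `N′ = L^nL^K`), cube `2L^e`, mass `0 < m² ≤ m₀²`, every cut-off `h` on the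
η′-lattice (`|h| ≤ H_h`, `supp h ⊂` unit block `b`) and every source `λ` on the η-lattice (`supp λ ⊂` unit block `b′`):
`N′^{−(d+1)}Σ_{x′}(h(x′)·[N′((A₀′⁻¹(λ∘π))(x′+e_μ) − (A₀′⁻¹(λ∘π))(x′)) − N((A₀⁻¹λ)(πx′+e_μ) − (A₀⁻¹λ)(πx′))])² ≤ (C·H_h·(L^{−γ∕2})^K·e^{−δ|b−b′|})²·N^{−(d+1)}Σ_yλ(y)²`
— Schur's test (part Ξ-a) on part S-f's GRADIENT rate profile with decay (part Π `rateProfile_fineSum_le` with `Λ = (L^{d+1}∕L²)·L`, paired ratio `t = L^{γ∕2−1} < 1`,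
unpaired ratio `L⁻¹ ≤ θ`), the pair operator read as a kernel operator on `λ∘π` (Q4a `inv_deriv_mulVec_eq_sum`, P″ `sum_comp_underPtN`), and part Π
`sum_sq_comp_underPtN`. [cite: Balaban1985BackgroundPropagators, Thm 3.1 (3.46) p.398 (second entry, shape); King1986, Prop. 3.9 (3.73) p.665, Prop. 3.8 (3.71) p.664, (2.17) p.653] -/
theorem fullPropDOp_l2_local_rate (hLodd : Odd L) (hL : 2 ≤ L) {a : ℝ} (ha : 0 < a) {m0sq : ℝ} (hm0 : 0 ≤ m0sq) {γ : ℝ}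
    (hγ0 : 0 ≤ γ) (hγ1 : γ < 1) :
    ∃ C δ : ℝ, 0 < C ∧ 0 < δ ∧ ∀ (K : ℕ), 1 ≤ K → ∀ (n : ℕ), 1 ≤ n →
      ∀ (e : ℕ) (M : Fin (d + 1) → ℕ) [∀ μ, NeZero (M μ)], (∀ μ, M μ = 2 * L ^ e) →
      ∀ (msq : ℝ), 0 < msq → msq ≤ m0sq →
      ∀ (μ : Fin (d + 1)) (lam : Tor (fine (L ^ K) M) → ℝ) (h : Tor (fine (L ^ n * L ^ K) M) → ℝ) (Hh : ℝ) (b b' : Tor M), 0 ≤ Hh →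
        (∀ x', |h x'| ≤ Hh) → (∀ x', h x' ≠ 0 → blockOf (L ^ n * L ^ K) M x' = b) → (∀ y, lam y ≠ 0 → blockOf (L ^ K) M y = b') →
        (((L ^ n * L ^ K : ℕ) : ℝ) ^ (d + 1))⁻¹ * ∑ x', (h x' *
            (((L ^ n * L ^ K : ℕ) : ℝ) * ((((fineOp (L ^ n * L ^ K) M (aK a L (K + n)) (((L ^ n * L ^ K : ℕ) : ℝ) ^ 2) msq)⁻¹
                *ᵥ (fun y' => lam (underPtN L K n M y'))) (x' + unitVec (fine (L ^ n * L ^ K) M) μ))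
              - (((fineOp (L ^ n * L ^ K) M (aK a L (K + n)) (((L ^ n * L ^ K : ℕ) : ℝ) ^ 2) msq)⁻¹
                *ᵥ (fun y' => lam (underPtN L K n M y'))) x'))
            - ((L ^ K : ℕ) : ℝ) * ((((fineOp (L ^ K) M (aK a L K) (((L ^ K : ℕ) : ℝ) ^ 2) msq)⁻¹ *ᵥ lam)
                (underPtN L K n M x' + unitVec (fine (L ^ K) M) μ))
              - (((fineOp (L ^ K) M (aK a L K) (((L ^ K : ℕ) : ℝ) ^ 2) msq)⁻¹ *ᵥ lam) (underPtN L K n M x'))))) ^ 2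
          ≤ (C * Hh * (((L : ℝ) ^ (-(γ / 2))) ^ K) * Real.exp (-(δ * tdistT M b b'))) ^ 2
              * ((((L ^ K : ℕ) : ℝ) ^ (d + 1))⁻¹ * ∑ y, lam y ^ 2) := by
  have hLr : (2 : ℝ) ≤ L := by exact_mod_cast hL
  have hL0 : (0 : ℝ) < L := by linarith
  have hL1 : (1 : ℝ) ≤ L := by linarith
  obtain ⟨C₀, δ₀, hC₀, hδ₀, HS⟩ := fullPropD_rateProfile_decay_unif (d := d) L hLodd hL ha hm0 hγ0 hγ1
  set δ₁ : ℝ := min δ₀ 1 with hδ₁def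
  have hδ₁0 : 0 < δ₁ := lt_min hδ₀ one_pos
  set θ : ℝ := (L : ℝ) ^ (-(γ / 2)) with hθdef
  have hθ0 : 0 ≤ θ := Real.rpow_nonneg hL0.le _
  set φ : ℝ := (L : ℝ) ^ (γ / 2) with hφdef
  have hφ0 : 0 ≤ φ := Real.rpow_nonneg hL0.le _
  set Λ : ℝ := (L : ℝ) ^ (d + 1) / (L : ℝ) ^ 2 * L with hΛdef
  have hΛ0 : 0 ≤ Λ := by positivity
  have hL1' : (1 : ℝ) < L := by linarith
  set t : ℝ := φ / L with htdef
  have ht0 : 0 ≤ t := by positivity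
  have hφL : φ < L := by
    calc φ < (L : ℝ) ^ (1 : ℝ) := Real.rpow_lt_rpow_of_exponent_lt hL1' (by linarith)
      _ = L := Real.rpow_one _
  have ht1 : t < 1 := by rw [htdef, div_lt_one hL0]; exact hφL
  set A : ℝ := (4 * ((d : ℝ) + 1) / δ₁) ^ (d + 1) * (1 / (1 - t) + 2) with hAdef
  have hA0 : 0 ≤ A := by
    have : 0 < 1 - t := by linarith
    positivity
  refine ⟨C₀ * A + 1, δ₀, by positivity, hδ₀, ?_⟩
  intro K hK n hn e M _ hM msq hmsq hcap μ lam h Hh b b' hHh hh hsh hsl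
  -- the ratios of part Π §1: `Λφ = L^{d+1}·t` (`t = φ∕L < 1`), `2Λ ≤ L^{d+1}` (`L ≥ 2`), `Λ ≤ L^{d+1}θ` (`L⁻¹ ≤ θ`)
  have hLd : (0 : ℝ) < (L : ℝ) ^ (d + 1) := by positivity
  have hΛeq : Λ * L = (L : ℝ) ^ (d + 1) := by
    rw [hΛdef, sq]; field_simp
  have hpair : Λ * φ ≤ (L : ℝ) ^ (d + 1) * t := by
    rw [htdef, ← hΛeq]
    exact le_of_eq (by field_simp)
  have hunp2 : 2 * Λ ≤ (L : ℝ) ^ (d + 1) := by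
    rw [← hΛeq]; nlinarith [mul_nonneg hΛ0 (sub_nonneg.mpr hLr)]
  have hunpθ : Λ ≤ (L : ℝ) ^ (d + 1) * θ := by
    have h1 : ((L : ℝ))⁻¹ ≤ θ := inv_le_theta L (by exact_mod_cast (show 1 ≤ L by omega)) hγ1.le
    calc Λ = (L : ℝ) ^ (d + 1) * (L : ℝ)⁻¹ := by rw [← hΛeq]; field_simp
      _ ≤ (L : ℝ) ^ (d + 1) * θ := mul_le_mul_of_nonneg_left h1 hLd.le
  -- the kernel and the profile majorant (at the rate `δ₁`, symmetric)
  set P : Tor (fine (L ^ n * L ^ K) M) → Tor (fine (L ^ n * L ^ K) M) → ℝ := fun x' y' =>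
      θ ^ K * ∑ i ∈ Finset.range K, (Λ * φ) ^ i * Real.exp (-(δ₁ * (tdistT (fine (L ^ n * L ^ K) M) x' y' * (L : ℝ) ^ i / ((L ^ n * L ^ K : ℕ) : ℝ))))
        + ∑ i ∈ Finset.range n, Λ ^ (K + i) * Real.exp (-(δ₁ * (tdistT (fine (L ^ n * L ^ K) M) x' y' * (L : ℝ) ^ (K + i) / ((L ^ n * L ^ K : ℕ) : ℝ))))
    with hPdef
  have hP0 : ∀ x' y', 0 ≤ P x' y' := fun x' y' => by positivity
  have hPsymm : ∀ x' y', P x' y' = P y' x' := fun x' y' => by simp only [hPdef, tdistT_symm (fine (L ^ n * L ^ K) M) x' y']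
  set k : Tor (fine (L ^ n * L ^ K) M) → Tor (fine (L ^ n * L ^ K) M) → ℝ := fun x' y' =>
      ((L ^ n * L ^ K : ℕ) : ℝ) * (constrainedProp (L ^ n * L ^ K) M (aK a L (K + n)) (((L ^ n * L ^ K : ℕ) : ℝ) ^ 2) msq
          (x' + unitVec (fine (L ^ n * L ^ K) M) μ) y'
        - constrainedProp (L ^ n * L ^ K) M (aK a L (K + n)) (((L ^ n * L ^ K : ℕ) : ℝ) ^ 2) msq x' y')
      - ((L ^ K : ℕ) : ℝ) * (constrainedProp (L ^ K) M (aK a L K) (((L ^ K : ℕ) : ℝ) ^ 2) msq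
          (underPtN L K n M x' + unitVec (fine (L ^ K) M) μ) (underPtN L K n M y')
        - constrainedProp (L ^ K) M (aK a L K) (((L ^ K : ℕ) : ℝ) ^ 2) msq (underPtN L K n M x') (underPtN L K n M y')) with hkdef
  have hk : ∀ x' y', |k x' y'| ≤ C₀ * P x' y' * Real.exp (-(δ₀ * tdistT M (blockOf (L ^ n * L ^ K) M x') (blockOf (L ^ n * L ^ K) M y'))) := by
    intro x' y'
    have h := HS K hK n hn e M hM msq hmsq hcap μ x' y'
    rw [blockOf_underPtN, blockOf_underPtN] at h
    refine h.trans (mul_le_mul_of_nonneg_right (mul_le_mul_of_nonneg_left ?_ hC₀.le) (Real.exp_pos _).le)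
    have hmono : ∀ s : ℝ, 0 ≤ s → Real.exp (-(δ₀ * (tdistT (fine (L ^ n * L ^ K) M) x' y' * s / ((L ^ n * L ^ K : ℕ) : ℝ))))
        ≤ Real.exp (-(δ₁ * (tdistT (fine (L ^ n * L ^ K) M) x' y' * s / ((L ^ n * L ^ K : ℕ) : ℝ)))) := fun s hs => by
      apply Real.exp_le_exp.mpr
      have h0 : 0 ≤ tdistT (fine (L ^ n * L ^ K) M) x' y' * s / ((L ^ n * L ^ K : ℕ) : ℝ) := by have := tdistT_nonneg (fine (L ^ n * L ^ K) M) x' y'; positivity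
      nlinarith [mul_le_mul_of_nonneg_right (min_le_left δ₀ 1) h0]
    have hΛφ : (L : ℝ) ^ (d + 1) / (L : ℝ) ^ 2 * L * (L : ℝ) ^ (γ / 2) = Λ * φ := by rw [hΛdef, hφdef]
    rw [hPdef, hΛφ]
    refine add_le_add (mul_le_mul_of_nonneg_left (Finset.sum_le_sum fun i _ => mul_le_mul_of_nonneg_left (hmono _ (by positivity))
      (by positivity)) (by positivity)) (Finset.sum_le_sum fun i _ => mul_le_mul_of_nonneg_left (hmono _ (by positivity)) (by positivity))
  have hrow : ∀ x', ∑ y', (((L ^ n * L ^ K : ℕ) : ℝ) ^ (d + 1))⁻¹ * P x' y' ≤ A * θ ^ K := fun x' =>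
    rateProfile_fineSum_le L hL (L ^ n * L ^ K) rfl M hδ₁0 (min_le_right _ _) hΛ0 hφ0 hθ0 ht0 ht1 hpair hunp2 hunpθ x'
  have hcol : ∀ y', ∑ x', (((L ^ n * L ^ K : ℕ) : ℝ) ^ (d + 1))⁻¹ * P x' y' ≤ A * θ ^ K := fun y' => by
    rw [Finset.sum_congr rfl fun x' _ => by rw [hPsymm x' y']]
    exact rateProfile_fineSum_le L hL (L ^ n * L ^ K) rfl M hδ₁0 (min_le_right _ _) hΛ0 hφ0 hθ0 ht0 ht1 hpair hunp2 hunpθ y'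
  -- supports on the η′-lattice
  have hsl' : ∀ y' : Tor (fine (L ^ n * L ^ K) M), lam (underPtN L K n M y') ≠ 0 → blockOf (L ^ n * L ^ K) M y' = b' := fun y' hy' => by
    rw [← blockOf_underPtN]; exact hsl _ hy'
  -- Schur
  have hS := l2_local_of_kernel_bound (L ^ n * L ^ K) M k P hC₀.le (by positivity : 0 ≤ A * θ ^ K) hP0 hk hrow hcol
    (fun y' => lam (underPtN L K n M y')) h b b' hHh hh hsh hsl'
  -- the pair operator as the kernel operator on `λ∘π`
  have hrepr : ∀ x', ((L ^ n * L ^ K : ℕ) : ℝ) * ((((fineOp (L ^ n * L ^ K) M (aK a L (K + n)) (((L ^ n * L ^ K : ℕ) : ℝ) ^ 2) msq)⁻¹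
                *ᵥ (fun y' => lam (underPtN L K n M y'))) (x' + unitVec (fine (L ^ n * L ^ K) M) μ))
              - (((fineOp (L ^ n * L ^ K) M (aK a L (K + n)) (((L ^ n * L ^ K : ℕ) : ℝ) ^ 2) msq)⁻¹
                *ᵥ (fun y' => lam (underPtN L K n M y'))) x'))
            - ((L ^ K : ℕ) : ℝ) * ((((fineOp (L ^ K) M (aK a L K) (((L ^ K : ℕ) : ℝ) ^ 2) msq)⁻¹ *ᵥ lam)
                (underPtN L K n M x' + unitVec (fine (L ^ K) M) μ))
              - (((fineOp (L ^ K) M (aK a L K) (((L ^ K : ℕ) : ℝ) ^ 2) msq)⁻¹ *ᵥ lam) (underPtN L K n M x')))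
      = ∑ y', (((L ^ n * L ^ K : ℕ) : ℝ) ^ (d + 1))⁻¹ * k x' y' * lam (underPtN L K n M y') := by
    intro x'
    rw [inv_deriv_mulVec_eq_sum, inv_deriv_mulVec_eq_sum]
    have hc : ∑ y : Tor (fine (L ^ K) M), (((L ^ K : ℕ) : ℝ) ^ (d + 1))⁻¹
          * (((L ^ K : ℕ) : ℝ) * (constrainedProp (L ^ K) M (aK a L K) (((L ^ K : ℕ) : ℝ) ^ 2) msq
              (underPtN L K n M x' + unitVec (fine (L ^ K) M) μ) y
            - constrainedProp (L ^ K) M (aK a L K) (((L ^ K : ℕ) : ℝ) ^ 2) msq (underPtN L K n M x') y)) * lam y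
        = ∑ y', (((L ^ n * L ^ K : ℕ) : ℝ) ^ (d + 1))⁻¹
          * (((L ^ K : ℕ) : ℝ) * (constrainedProp (L ^ K) M (aK a L K) (((L ^ K : ℕ) : ℝ) ^ 2) msq
              (underPtN L K n M x' + unitVec (fine (L ^ K) M) μ) (underPtN L K n M y')
            - constrainedProp (L ^ K) M (aK a L K) (((L ^ K : ℕ) : ℝ) ^ 2) msq (underPtN L K n M x') (underPtN L K n M y')))
            * lam (underPtN L K n M y') := by
      have hsc := sum_comp_underPtN L K n M
        (fun y => (((L ^ K : ℕ) : ℝ) * (constrainedProp (L ^ K) M (aK a L K) (((L ^ K : ℕ) : ℝ) ^ 2) msq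
              (underPtN L K n M x' + unitVec (fine (L ^ K) M) μ) y
            - constrainedProp (L ^ K) M (aK a L K) (((L ^ K : ℕ) : ℝ) ^ 2) msq (underPtN L K n M x') y)) * lam y)
      have hcc : (((L ^ n * L ^ K : ℕ) : ℝ) ^ (d + 1))⁻¹ * (((L ^ n : ℕ) : ℝ) ^ (d + 1)) = (((L ^ K : ℕ) : ℝ) ^ (d + 1))⁻¹ := by
        push_cast
        have h1 : ((L : ℝ) ^ n) ^ (d + 1) ≠ 0 := by positivity
        have h2 : ((L : ℝ) ^ K) ^ (d + 1) ≠ 0 := by positivity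
        field_simp
        ring
      symm
      rw [Finset.sum_congr rfl fun y' _ => (mul_assoc _ _ _), ← Finset.mul_sum, hsc, ← mul_assoc, hcc, Finset.mul_sum]
      exact Finset.sum_congr rfl fun y _ => (mul_assoc _ _ _).symm
    rw [hc, ← Finset.sum_sub_distrib]
    exact Finset.sum_congr rfl fun y' _ => by rw [hkdef]; ring
  rw [Finset.sum_congr rfl fun x' _ => by rw [hrepr x']]
  -- assemble: Schur bound × the weight, `N′^{−(d+1)}Σ(λ∘π)² = N^{−(d+1)}Σλ²`
  have hw0 : 0 ≤ (((L ^ n * L ^ K : ℕ) : ℝ) ^ (d + 1))⁻¹ := by positivity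
  have hnorm := sum_sq_comp_underPtN L K n M lam
  calc (((L ^ n * L ^ K : ℕ) : ℝ) ^ (d + 1))⁻¹ * ∑ x', (h x' * ∑ y', (((L ^ n * L ^ K : ℕ) : ℝ) ^ (d + 1))⁻¹ * k x' y' * lam (underPtN L K n M y')) ^ 2
      ≤ (((L ^ n * L ^ K : ℕ) : ℝ) ^ (d + 1))⁻¹ * ((C₀ * (A * θ ^ K) * Hh * Real.exp (-(δ₀ * tdistT M b b'))) ^ 2
          * ∑ y', lam (underPtN L K n M y') ^ 2) := mul_le_mul_of_nonneg_left hS hw0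
    _ = (C₀ * A * Hh * θ ^ K * Real.exp (-(δ₀ * tdistT M b b'))) ^ 2
          * ((((L ^ n * L ^ K : ℕ) : ℝ) ^ (d + 1))⁻¹ * ∑ y', lam (underPtN L K n M y') ^ 2) := by ring
    _ = (C₀ * A * Hh * θ ^ K * Real.exp (-(δ₀ * tdistT M b b'))) ^ 2 * ((((L ^ K : ℕ) : ℝ) ^ (d + 1))⁻¹ * ∑ y, lam y ^ 2) := by
        rw [hnorm]
    _ ≤ ((C₀ * A + 1) * Hh * θ ^ K * Real.exp (-(δ₀ * tdistT M b b'))) ^ 2 * ((((L ^ K : ℕ) : ℝ) ^ (d + 1))⁻¹ * ∑ y, lam y ^ 2) := by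
        refine mul_le_mul_of_nonneg_right (pow_le_pow_left₀ (by positivity) ?_ 2)
          (mul_nonneg (by positivity) (Finset.sum_nonneg fun y _ => sq_nonneg _))
        have : 0 ≤ Hh * θ ^ K * Real.exp (-(δ₀ * tdistT M b b')) := by positivity
        nlinarith

end Summit.QuantumFields.YangMills.BalabanUVNodes.N15KingModelRung.Curved
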